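import Mathlib.NumberTheory.ArithmeticFunction.Moebius
import Mathlib.Data.Int.CardIntervalMod
import Mathlib.Data.Nat.Squarefree
import Mathlib.Analysis.PSeries
import Mathlib.Analysis.Real.Sqrt
import HarnessLib

/-!
# Square-free integers in an arithmetic progression, with error `O(√N)`

For a modulus `q ≥ 1` and a residue `r ∈ ℤ`, the number of square-free integers `0 < n ≤ N` with
`n ≡ r (mod q)` is `g(q, r) N + O(√N)` with an ABSOLUTE implied constant (`3`), where
`g(q, r) = ∑_{d ≥ 1} μ(d) [gcd(d², q) ∣ r] / lcm(d², q)` (`abs_card_squarefree_progression_sub_le`).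
This is the Eratosthenes–Legendre sieve by squares of Prachar's theorem (K. Prachar, *Über die
kleinste quadratfreie Zahl einer arithmetischen Reihe*, Monatsh. Math. 62 (1958) 173–176) in the
crude form of Tenenbaum, *Introduction to analytic and probabilistic number theory*, I.3.7: detect
square-freeness by `∑_{d² ∣ n} μ(d)` (`sum_moebius_sq_dvd_eq`), swap sums, count each class
`n ≡ r (q), d² ∣ n` — empty unless `gcd(d², q) ∣ r`, else one class modulo `lcm(d², q)`
(`abs_card_modEq_dvd_sub_le`) — with error `≤ 1` for `d ≤ √N`, and bound the tail
`N ∑_{d > √N} d⁻² ≤ 2√N`. The Euler-product evaluation of `g(q, r)` is in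
`SquarefreeProgressionsDensity`; the application to fundamental discriminants (Taniguchi–Thorne,
Lemma 21) is in `QuadraticFields/ThreeTorsionMeanProofs`.

Design: no new definitions — the density is written out as the `tsum` above, and square-freeness on
`ℤ` is decided by whatever instance the user supplies (`[DecidablePred (Squarefree : ℤ → Prop)]`).

## Mathlib search

`ArithmeticFunction.moebius_mul_coe_zeta` (`∑_{e ∣ n} μ(e) = [n = 1]`, a private copy of the tree's
`sum_divisors_moebius_eq_ite`), `Nat.sq_mul_squarefree_of_pos`,
`Int.Ioc_filter_modEq_card`, `Int.modEq_and_modEq_iff_modEq_lcm`, `Nat.gcd_eq_gcd_ab`,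
`sum_Ioo_inv_sq_le`, `Real.tsum_le_of_sum_range_le`, `Summable.sum_add_tsum_nat_add`.
-/

noncomputable section

open Finset ArithmeticFunction
open scoped ArithmeticFunction.Moebius

namespace Literature.NumberTheory.Sieve

/-! ### The detector `∑_{d² ∣ n} μ(d) = [n square-free]` -/

/-- For `c` square-free and `b ≥ 1`: `d² ∣ b² c ↔ d ∣ b`. [folklore] -/
theorem sq_dvd_sq_mul_iff_of_squarefree {b c d : ℕ} (hb : 0 < b) (hc : Squarefree c) :
    d ^ 2 ∣ b ^ 2 * c ↔ d ∣ b := by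
  refine ⟨fun h => ?_, fun h => Dvd.dvd.mul_right (pow_dvd_pow_of_dvd h 2) c⟩
  obtain ⟨g, d', b', hg, hcop, rfl, rfl⟩ := Nat.exists_coprime' (Nat.gcd_pos_of_pos_right d hb)
  have h1 : d' ^ 2 ∣ b' ^ 2 * c := by
    have h' : g ^ 2 * d' ^ 2 ∣ g ^ 2 * (b' ^ 2 * c) := by
      convert h using 1 <;> ring
    exact (Nat.mul_dvd_mul_iff_left (by positivity)).mp h'
  have h2 : d' ^ 2 ∣ c := (Nat.Coprime.pow 2 2 hcop).dvd_of_dvd_mul_left h1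
  have h3 : d' = 1 := Nat.isUnit_iff.mp (hc d' (by simpa [sq] using h2))
  subst h3
  simp

/-- `∑_{e ∣ n} μ(e) = [n = 1]` (Möbius inversion of the constant `1`). [folklore] -/
private theorem sum_divisors_moebius_int_eq_ite (n : ℕ) :
    ∑ e ∈ n.divisors, (μ e : ℤ) = if n = 1 then 1 else 0 := by
  have h := congrArg (fun f : ArithmeticFunction ℤ => f n) ArithmeticFunction.moebius_mul_coe_zeta
  simpa only [ArithmeticFunction.coe_mul_zeta_apply, ArithmeticFunction.one_apply] using h

/-- **The Legendre detector of square-free numbers**: for `n ≥ 1` and `√n ≤ K`,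
`∑_{1 ≤ d ≤ K, d² ∣ n} μ(d) = 1` if `n` is square-free and `0` otherwise. [folklore] -/
theorem sum_moebius_sq_dvd_eq {n K : ℕ} (hn : 0 < n) (hK : Nat.sqrt n ≤ K) :
    ∑ d ∈ Icc 1 K, (if d ^ 2 ∣ n then (μ d : ℤ) else 0) = if Squarefree n then 1 else 0 := by
  obtain ⟨c, b, -, hb0, hbc, hc⟩ := Nat.sq_mul_squarefree_of_pos hn
  rw [← Finset.sum_filter]
  have hset : (Icc 1 K).filter (fun d => d ^ 2 ∣ n) = b.divisors := by
    ext d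
    rw [mem_filter, mem_Icc, Nat.mem_divisors, ← hbc, sq_dvd_sq_mul_iff_of_squarefree hb0 hc]
    constructor
    · rintro ⟨-, h⟩
      exact ⟨h, hb0.ne'⟩
    · rintro ⟨h, -⟩
      refine ⟨⟨Nat.pos_of_dvd_of_pos h hb0, ?_⟩, h⟩
      have h2 : d ^ 2 ≤ n :=
        Nat.le_of_dvd hn (hbc ▸ (sq_dvd_sq_mul_iff_of_squarefree hb0 hc).mpr h)
      exact (Nat.le_sqrt'.mpr h2).trans hK
  rw [hset, sum_divisors_moebius_int_eq_ite]
  by_cases hb1 : b = 1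
  · subst hb1
    simp [← hbc, hc]
  · have hns : ¬ Squarefree n := by
      intro hsq
      rw [← hbc] at hsq
      exact hb1 (Nat.isUnit_iff.mp (hsq b ⟨c, by ring⟩))
    simp [hb1, hns]

/-! ### One class `n ≡ r (mod q)` cut by `e ∣ n` -/

/-- If `gcd(e, q) ∣ r` there is `c ≡ r (mod q)` with `e ∣ c` (Bézout). [folklore] -/
theorem exists_modEq_and_dvd {q e : ℕ} {r : ℤ} (h : ((e.gcd q : ℕ) : ℤ) ∣ r) :
    ∃ c : ℤ, c ≡ r [ZMOD q] ∧ (e : ℤ) ∣ c := by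
  obtain ⟨t, ht⟩ := h
  refine ⟨(e : ℤ) * e.gcdA q * t, ?_, ⟨e.gcdA q * t, by ring⟩⟩
  rw [Int.modEq_iff_dvd]
  refine ⟨e.gcdB q * t, ?_⟩
  rw [ht, Nat.gcd_eq_gcd_ab]
  ring

/-- With `c` as in `exists_modEq_and_dvd`, the conditions `n ≡ r (mod q)`, `e ∣ n` cut out exactly the
class of `c` modulo `lcm(e, q)`. [folklore] -/
theorem modEq_and_dvd_iff {q e : ℕ} {r c : ℤ} (hc : c ≡ r [ZMOD q]) (hec : (e : ℤ) ∣ c) (n : ℤ) :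
    (n ≡ r [ZMOD q] ∧ (e : ℤ) ∣ n) ↔ n ≡ c [ZMOD ((e.lcm q : ℕ) : ℤ)] := by
  have hl : ((e.lcm q : ℕ) : ℤ) = ((Int.lcm (e : ℤ) (q : ℤ) : ℕ) : ℤ) := by
    simp [Int.lcm]
  rw [hl, ← Int.modEq_and_modEq_iff_modEq_lcm]
  constructor
  · rintro ⟨h1, h2⟩
    exact ⟨(Int.modEq_zero_iff_dvd.mpr h2).trans (Int.modEq_zero_iff_dvd.mpr hec).symm,
      h1.trans hc.symm⟩
  · rintro ⟨h1, h2⟩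
    refine ⟨h2.trans hc, ?_⟩
    exact Int.modEq_zero_iff_dvd.mp (h1.trans (Int.modEq_zero_iff_dvd.mpr hec))

/-- `|#{0 < n ≤ N : n ≡ c (mod L)} − N/L| ≤ 1` (`L ≥ 1`). [folklore] -/
theorem abs_card_intIoc_filter_modEq_sub_div_le {L : ℕ} (hL : 0 < L) (c : ℤ) (N : ℕ) :
    |(#{n ∈ Ioc (0 : ℤ) N | n ≡ c [ZMOD L]} : ℝ) - N / L| ≤ 1 := by
  have h := Int.Ioc_filter_modEq_card (0 : ℤ) N (r := (L : ℤ)) (by exact_mod_cast hL) c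
  set x : ℚ := (((N : ℤ) : ℚ) - (c : ℚ)) / ((L : ℤ) : ℚ) with hx
  set y : ℚ := (((0 : ℤ) : ℚ) - (c : ℚ)) / ((L : ℤ) : ℚ) with hy
  have hLq : (0 : ℚ) < ((L : ℤ) : ℚ) := by exact_mod_cast hL
  have hxy : x - y = (N : ℚ) / (L : ℚ) := by
    rw [hx, hy]
    push_cast
    ring
  have hyx : y ≤ x := by
    have : (0 : ℚ) ≤ (N : ℚ) / (L : ℚ) := by positivity
    linarith
  have hmax : max (⌊x⌋ - ⌊y⌋) 0 = ⌊x⌋ - ⌊y⌋ :=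
    max_eq_left (sub_nonneg.mpr (Int.floor_mono hyx))
  rw [hmax] at h
  have hq : |((⌊x⌋ - ⌊y⌋ : ℤ) : ℚ) - (N : ℚ) / (L : ℚ)| ≤ 1 := by
    rw [← hxy, abs_le]
    have h1 := Int.floor_le x
    have h2 := Int.lt_floor_add_one x
    have h3 := Int.floor_le y
    have h4 := Int.lt_floor_add_one y
    push_cast
    constructor <;> linarith
  have hcardR : (#{n ∈ Ioc (0 : ℤ) N | n ≡ c [ZMOD L]} : ℝ) = (((⌊x⌋ - ⌊y⌋ : ℤ) : ℚ) : ℝ) := by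
    have h' : ((#{n ∈ Ioc (0 : ℤ) N | n ≡ c [ZMOD L]} : ℤ) : ℝ) = (((⌊x⌋ - ⌊y⌋ : ℤ) : ℚ) : ℝ) := by
      rw [h]; push_cast; ring
    rw [← h']; push_cast; ring
  rw [hcardR, show (N : ℝ) / L = (((N : ℚ) / (L : ℚ) : ℚ) : ℝ) by push_cast; ring]
  rw [← Rat.cast_sub, ← Rat.cast_abs, ← Rat.cast_one, Rat.cast_le]
  exact hq

/-- **One progression cut by one divisibility.** For `q, e ≥ 1`, `r ∈ ℤ`, `N ≥ 0`:
`|#{0 < n ≤ N : n ≡ r (mod q), e ∣ n} − [gcd(e, q) ∣ r] · N/lcm(e, q)| ≤ 1`. [folklore] -/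
theorem abs_card_modEq_dvd_sub_le {q e : ℕ} (hq : 0 < q) (he : 0 < e) (r : ℤ) (N : ℕ) :
    |(#{n ∈ Ioc (0 : ℤ) N | n ≡ r [ZMOD q] ∧ (e : ℤ) ∣ n} : ℝ)
      - (if ((e.gcd q : ℕ) : ℤ) ∣ r then (N : ℝ) / (e.lcm q : ℕ) else 0)| ≤ 1 := by
  split_ifs with h
  · obtain ⟨c, hc, hec⟩ := exists_modEq_and_dvd h
    have hset : {n ∈ Ioc (0 : ℤ) N | n ≡ r [ZMOD q] ∧ (e : ℤ) ∣ n}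
        = {n ∈ Ioc (0 : ℤ) N | n ≡ c [ZMOD ((e.lcm q : ℕ) : ℤ)]} :=
      Finset.filter_congr fun n _ => modEq_and_dvd_iff hc hec n
    rw [hset]
    exact abs_card_intIoc_filter_modEq_sub_div_le (Nat.lcm_pos he hq) c N
  · have hset : {n ∈ Ioc (0 : ℤ) N | n ≡ r [ZMOD q] ∧ (e : ℤ) ∣ n} = ∅ := by
      refine Finset.filter_eq_empty_iff.mpr fun n _ hn => h ?_
      obtain ⟨h1, h2⟩ := hn
      have hg1 : ((e.gcd q : ℕ) : ℤ) ∣ n :=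
        (Int.natCast_dvd_natCast.mpr (Nat.gcd_dvd_left e q)).trans h2
      have hg2 : ((e.gcd q : ℕ) : ℤ) ∣ r - n :=
        (Int.natCast_dvd_natCast.mpr (Nat.gcd_dvd_right e q)).trans (Int.ModEq.dvd h1)
      simpa using dvd_add hg1 hg2
    rw [hset]
    simp

/-! ### The tail `∑_{d > M} d⁻²` and the summability of the density series -/

/-- `∑_{d ≥ 0} (d + M + 1)⁻² ≤ 2/(M + 1)`. [folklore] -/
theorem tsum_one_div_sq_shift_le (M : ℕ) :
    ∑' d : ℕ, 1 / ((d + (M + 1) : ℕ) : ℝ) ^ 2 ≤ 2 / ((M : ℝ) + 1) := by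
  refine Real.tsum_le_of_sum_range_le (fun n => by positivity) fun K => ?_
  have hshift : ∑ d ∈ range K, 1 / (((d + (M + 1) : ℕ) : ℝ)) ^ 2 =
      ∑ i ∈ Ioo M (M + 1 + K), ((i : ℝ) ^ 2)⁻¹ := by
    have hI : Ioo M (M + 1 + K) = Ico (M + 1) (M + 1 + K) := by
      ext i
      simp only [mem_Ioo, mem_Ico]
      omega
    rw [hI, Finset.sum_Ico_eq_sum_range]
    simp only [show M + 1 + K - (M + 1) = K by omega, one_div]
    refine sum_congr rfl fun i _ => ?_
    rw [add_comm]
  rw [hshift]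
  exact sum_Ioo_inv_sq_le M (M + 1 + K)

/-- The terms of the density series are `≤ d⁻²` in absolute value (`q ≥ 1`). [folklore] -/
theorem abs_moebius_mul_density_term_le {q : ℕ} (hq : 0 < q) (r : ℤ) (d : ℕ) :
    |(μ d : ℝ) * (if (((d ^ 2).gcd q : ℕ) : ℤ) ∣ r then 1 / (((d ^ 2).lcm q : ℕ) : ℝ) else 0)|
      ≤ 1 / (d : ℝ) ^ 2 := by
  rcases Nat.eq_zero_or_pos d with rfl | hd
  · simp
  have hμ : |(μ d : ℝ)| ≤ 1 := by
    rcases ArithmeticFunction.moebius_eq_or d with h | h | h <;> simp [h]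
  rw [abs_mul]
  refine (mul_le_mul hμ le_rfl (abs_nonneg _) zero_le_one).trans ?_
  rw [one_mul]
  split_ifs
  · rw [abs_of_nonneg (by positivity)]
    have hl : d ^ 2 ≤ (d ^ 2).lcm q :=
      Nat.le_of_dvd (Nat.lcm_pos (by positivity) hq) (Nat.dvd_lcm_left _ _)
    have hl' : ((d : ℝ)) ^ 2 ≤ (((d ^ 2).lcm q : ℕ) : ℝ) := by exact_mod_cast hl
    exact one_div_le_one_div_of_le (by positivity) hl'
  · rw [abs_zero]
    positivity

/-- The density series `∑_d μ(d) [gcd(d², q) ∣ r]/lcm(d², q)` converges absolutely. [folklore] -/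
theorem summable_moebius_mul_density_term {q : ℕ} (hq : 0 < q) (r : ℤ) :
    Summable fun d : ℕ =>
      (μ d : ℝ) * (if (((d ^ 2).gcd q : ℕ) : ℤ) ∣ r then 1 / (((d ^ 2).lcm q : ℕ) : ℝ) else 0) :=
  Summable.of_norm_bounded (g := fun d : ℕ => 1 / (d : ℝ) ^ 2)
    (Real.summable_one_div_nat_pow.mpr one_lt_two) fun d => by
      rw [Real.norm_eq_abs]
      exact abs_moebius_mul_density_term_le hq r d

/-! ### The count -/

/-- **Square-free integers in a progression** (Prachar; Tenenbaum I.3.7): for `q ≥ 1`, `r ∈ ℤ`,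
`N ≥ 0`, with `g(q, r) = ∑_{d ≥ 1} μ(d) [gcd(d², q) ∣ r] / lcm(d², q)`,
`|#{0 < n ≤ N : n ≡ r (mod q), n square-free} − g(q, r) N| ≤ 3 √N`. [folklore] -/
theorem abs_card_squarefree_progression_sub_le [DecidablePred (Squarefree : ℤ → Prop)]
    {q : ℕ} (hq : 0 < q) (r : ℤ) (N : ℕ) :
    |(#{n ∈ Ioc (0 : ℤ) N | n ≡ r [ZMOD q] ∧ Squarefree n} : ℝ)
      - (∑' d : ℕ, (μ d : ℝ) *
          (if (((d ^ 2).gcd q : ℕ) : ℤ) ∣ r then 1 / (((d ^ 2).lcm q : ℕ) : ℝ) else 0)) * N|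
      ≤ 3 * Real.sqrt N := by
  set M := Nat.sqrt N with hM
  set t : ℕ → ℝ := fun d => (μ d : ℝ) *
    (if (((d ^ 2).gcd q : ℕ) : ℤ) ∣ r then 1 / (((d ^ 2).lcm q : ℕ) : ℝ) else 0) with ht
  set A : ℕ → ℕ := fun d => #{n ∈ Ioc (0 : ℤ) N | n ≡ r [ZMOD q] ∧ ((d ^ 2 : ℕ) : ℤ) ∣ n} with hA
  -- Step 1: Legendre's identity and the swap of summations.
  have hcard : (#{n ∈ Ioc (0 : ℤ) N | n ≡ r [ZMOD q] ∧ Squarefree n} : ℝ)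
      = ∑ d ∈ Icc 1 M, (μ d : ℝ) * (A d : ℝ) := by
    have h1 : (#{n ∈ Ioc (0 : ℤ) N | n ≡ r [ZMOD q] ∧ Squarefree n} : ℝ)
        = ∑ n ∈ (Ioc (0 : ℤ) N).filter (fun n => n ≡ r [ZMOD q]),
            (if Squarefree n then (1 : ℝ) else 0) := by
      rw [← Finset.filter_filter, natCast_card_filter]
    have h2 : ∀ n ∈ (Ioc (0 : ℤ) N).filter (fun n => n ≡ r [ZMOD q]),
        (if Squarefree n then (1 : ℝ) else 0)
          = ∑ d ∈ Icc 1 M, (if ((d ^ 2 : ℕ) : ℤ) ∣ n then (μ d : ℝ) else 0) := by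
      intro n hn
      simp only [mem_filter, mem_Ioc] at hn
      obtain ⟨⟨hn0, hnN⟩, -⟩ := hn
      have hpos : 0 < n.natAbs := Int.natAbs_pos.mpr hn0.ne'
      have hle : Nat.sqrt n.natAbs ≤ M := Nat.sqrt_le_sqrt (by omega)
      have key := congrArg (fun z : ℤ => (z : ℝ)) (sum_moebius_sq_dvd_eq hpos hle)
      push_cast at key
      simp_rw [← Int.squarefree_natAbs (n := n), Int.natCast_dvd]
      exact key.symm
    rw [h1, sum_congr rfl h2, sum_comm]
    refine sum_congr rfl fun d _ => ?_
    have h3 : (A d : ℝ) = ∑ n ∈ (Ioc (0 : ℤ) N).filter (fun n => n ≡ r [ZMOD q]),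
        (if ((d ^ 2 : ℕ) : ℤ) ∣ n then (1 : ℝ) else 0) := by
      show ((#{n ∈ Ioc (0 : ℤ) N | n ≡ r [ZMOD q] ∧ ((d ^ 2 : ℕ) : ℤ) ∣ n} : ℕ) : ℝ) = _
      rw [← Finset.filter_filter, natCast_card_filter]
    rw [h3, mul_sum]
    exact sum_congr rfl fun n _ => by rw [mul_boole]
  -- Step 2: each class is counted with error ≤ 1.
  have hstep2 : |∑ d ∈ Icc 1 M, (μ d : ℝ) * (A d : ℝ) - (∑ d ∈ Icc 1 M, t d) * N| ≤ M := by
    rw [sum_mul, ← sum_sub_distrib]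
    refine (abs_sum_le_sum_abs _ _).trans ?_
    have hb : ∀ d ∈ Icc 1 M, |(μ d : ℝ) * (A d : ℝ) - t d * N| ≤ 1 := by
      intro d hd
      rw [mem_Icc] at hd
      have hmain := abs_card_modEq_dvd_sub_le hq (pow_pos hd.1 2) r N
      have heq : (μ d : ℝ) * (A d : ℝ) - t d * N = (μ d : ℝ) * ((A d : ℝ)
          - (if (((d ^ 2).gcd q : ℕ) : ℤ) ∣ r then (N : ℝ) / (((d ^ 2).lcm q : ℕ) : ℝ) else 0)) := by
        simp only [ht]
        split_ifs <;> ring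
      have hμ : |(μ d : ℝ)| ≤ 1 := by
        rcases ArithmeticFunction.moebius_eq_or d with h | h | h <;> simp [h]
      rw [heq, abs_mul]
      calc |(μ d : ℝ)| * _ ≤ 1 * 1 := mul_le_mul hμ hmain (abs_nonneg _) zero_le_one
        _ = 1 := one_mul 1
    refine (sum_le_card_nsmul _ _ 1 hb).trans ?_
    rw [Nat.card_Icc]
    simp
  -- Step 3: the tail of the density series.
  have hsum : Summable t := summable_moebius_mul_density_term hq r
  have htail : |(∑ d ∈ Icc 1 M, t d) - ∑' d, t d| ≤ 2 / ((M : ℝ) + 1) := by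
    have hsplit := hsum.sum_add_tsum_nat_add (M + 1)
    have hrange : ∑ d ∈ range (M + 1), t d = ∑ d ∈ Icc 1 M, t d := by
      rw [range_eq_Ico, sum_eq_sum_Ico_succ_bot (Nat.succ_pos M), Nat.succ_eq_add_one,
        Finset.Ico_add_one_right_eq_Icc, zero_add]
      simp [ht]
    rw [hrange] at hsplit
    have hsum_tail : Summable (fun d => t (d + (M + 1))) :=
      hsum.comp_injective (add_left_injective (M + 1))
    have hsq_tail : Summable (fun d : ℕ => 1 / ((d + (M + 1) : ℕ) : ℝ) ^ 2) :=
      (Real.summable_one_div_nat_pow.mpr one_lt_two).comp_injective (add_left_injective (M + 1))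
    calc |(∑ d ∈ Icc 1 M, t d) - ∑' d, t d| = |∑' d, t (d + (M + 1))| := by
          rw [← hsplit]; simp
      _ = ‖∑' d, t (d + (M + 1))‖ := (Real.norm_eq_abs _).symm
      _ ≤ ∑' d, ‖t (d + (M + 1))‖ := norm_tsum_le_tsum_norm hsum_tail.norm
      _ ≤ ∑' d : ℕ, 1 / ((d + (M + 1) : ℕ) : ℝ) ^ 2 :=
          Summable.tsum_le_tsum (fun d => by
            rw [Real.norm_eq_abs]; exact abs_moebius_mul_density_term_le hq r _)
            hsum_tail.norm hsq_tail
      _ ≤ 2 / ((M : ℝ) + 1) := tsum_one_div_sq_shift_le M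
  -- Step 4: `M ≤ √N` and `N/(M+1) ≤ √N`.
  have hMle : (M : ℝ) ≤ Real.sqrt N := by
    rw [Real.le_sqrt (by positivity) (by positivity)]
    exact_mod_cast Nat.sqrt_le' N
  have hNdiv : (N : ℝ) / ((M : ℝ) + 1) ≤ Real.sqrt N := by
    rw [div_le_iff₀ (by positivity)]
    have hs : Real.sqrt N ≤ (M : ℝ) + 1 := by
      have hlt : (N : ℝ) ≤ ((M : ℝ) + 1) ^ 2 := by exact_mod_cast (Nat.lt_succ_sqrt' N).le
      calc Real.sqrt N ≤ Real.sqrt (((M : ℝ) + 1) ^ 2) := Real.sqrt_le_sqrt hlt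
        _ = (M : ℝ) + 1 := Real.sqrt_sq (by positivity)
    calc (N : ℝ) = Real.sqrt N * Real.sqrt N := (Real.mul_self_sqrt (by positivity)).symm
      _ ≤ Real.sqrt N * ((M : ℝ) + 1) := mul_le_mul_of_nonneg_left hs (Real.sqrt_nonneg _)
  -- Assembly.
  rw [hcard]
  have hdecomp : ∑ d ∈ Icc 1 M, (μ d : ℝ) * (A d : ℝ) - (∑' d, t d) * N
      = (∑ d ∈ Icc 1 M, (μ d : ℝ) * (A d : ℝ) - (∑ d ∈ Icc 1 M, t d) * N)
        + ((∑ d ∈ Icc 1 M, t d) - ∑' d, t d) * N := by ring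
  rw [hdecomp]
  refine (abs_add_le _ _).trans ?_
  rw [abs_mul, Nat.abs_cast]
  have h3 : |(∑ d ∈ Icc 1 M, t d) - ∑' d, t d| * (N : ℝ) ≤ 2 * Real.sqrt N := by
    calc |(∑ d ∈ Icc 1 M, t d) - ∑' d, t d| * (N : ℝ) ≤ 2 / ((M : ℝ) + 1) * N :=
          mul_le_mul_of_nonneg_right htail (by positivity)
      _ = 2 * ((N : ℝ) / ((M : ℝ) + 1)) := by ring
      _ ≤ 2 * Real.sqrt N := by linarith
  linarith

/-- The same count for the reflected classes `σ n ≡ r (mod q)`, `σ = ±1` (the density series is even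
in `r`). [folklore] -/
theorem abs_card_squarefree_progression_sign_sub_le [DecidablePred (Squarefree : ℤ → Prop)]
    {q : ℕ} (hq : 0 < q) (r : ℤ) {σ : ℤ} (hσ : σ = 1 ∨ σ = -1) (N : ℕ) :
    |(#{n ∈ Ioc (0 : ℤ) N | σ * n ≡ r [ZMOD q] ∧ Squarefree n} : ℝ)
      - (∑' d : ℕ, (μ d : ℝ) *
          (if (((d ^ 2).gcd q : ℕ) : ℤ) ∣ r then 1 / (((d ^ 2).lcm q : ℕ) : ℝ) else 0)) * N|
      ≤ 3 * Real.sqrt N := by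
  rcases hσ with rfl | rfl
  · simpa using abs_card_squarefree_progression_sub_le hq r N
  · have h := abs_card_squarefree_progression_sub_le hq (-r) N
    have hset : {n ∈ Ioc (0 : ℤ) N | -1 * n ≡ r [ZMOD q] ∧ Squarefree n}
        = {n ∈ Ioc (0 : ℤ) N | n ≡ -r [ZMOD q] ∧ Squarefree n} := by
      refine Finset.filter_congr fun n _ => ?_
      rw [neg_one_mul]
      exact ⟨fun h => ⟨by simpa using h.1.neg, h.2⟩, fun h => ⟨by simpa using h.1.neg, h.2⟩⟩
    rw [hset]
    simpa only [dvd_neg] using h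

end Literature.NumberTheory.Sieve

end
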